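import Mathlib.NumberTheory.Transcendental.Liouville.LiouvilleWith
import Mathlib.Analysis.SpecialFunctions.Log.Basic
import HarnessLib

/-!
# The record irrationality measure of `log 2` (Marcovecchio 2009)

Topic `Literature/NumberTheory/Irrationality/Marcovecchio2009`. Typed, cited statement (no proof) of
the main result of R. Marcovecchio, *The Rhin–Viola method for log 2*, Acta Arith. **139** (2009)
147–184 [Marcovecchio2009]: the irrationality exponent of `log 2` satisfies `μ(log 2) < 3.57455391`.
PRIMARY SOURCE read on the page (Acta Arith., held: `paper:doi-10-4064-aa139-2-5`, p. 147):
"We say that an irrational number `α` has an irrationality measure `μ` if for all `ε > 0` there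
exists a constant `v₀ = v₀(ε)` for which `|α − u/v| > v^{−μ−ε}` for all integers `u` and `v` with
`v ≥ v₀`. We denote by `μ(α)` the least of such `μ`. One of the aims of this paper is to improve
Rukhadze's result as follows: **Theorem 1.1.** (1) `μ(log 2) < 3.57455391`." The previous record
quoted there is Rukhadze's `3.89139978` (1987); the paper also proves the non-quadraticity measure
`μ₂(log 2) < 15.65142025` (Theorem 1.2, p. 148), not typed here.

Rendering (as in `RhinViola2001/ZetaThreeMeasure.lean`, `Zudilin2014/ZetaTwoMeasure.lean`):
`μ(x) < c` implies `¬ LiouvilleWith p x` for every `p ≥ c` (Mathlib's `LiouvilleWith p x`: for some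
`C`, infinitely many `m/n` with `|x − m/n| < C/n^p`).

Cell pub-zeta5 (HONEST FRAMING: systematic search; no irrationality claim unless certified): a
RECORD entry for the measure lane (target T3: a certified improvement of a printed measure); the
comparison scale for the cell's criterion C4 (`Summits/…/Zeta5Search/MeasureRecords.lean`,
`logTwo_newRecord_of_exponentLE`). Nothing here is used as a hypothesis anywhere.
-/

noncomputable section

namespace Literature.NumberTheory.Irrationality.Marcovecchio2009

/-- **Marcovecchio 2009, Theorem 1.1 (1)** (named fact, statement only): `μ(log 2) < 3.57455391`;
rendered as: for every exponent `p ≥ 3.57455391`, `log 2` is not `p`-Liouville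
(`¬ LiouvilleWith p (Real.log 2)`).
[cite: Marcovecchio2009, §1 Theorem 1.1 (1), p. 147 (μ(log 2) < 3.57455391)] -/
def logTwo_irrationalityExponent_lt : Prop :=
  ∀ p : ℝ, (3.57455391 : ℝ) ≤ p → ¬ LiouvilleWith p (Real.log 2)

end Literature.NumberTheory.Irrationality.Marcovecchio2009
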